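import Summits.AtomisticToContinuum.HydrodynamicLimit.Theorems.RelayRaceLocalityNearConstantShortTimeHLMeansPin
import Summits.AtomisticToContinuum.HydrodynamicLimit.Theorems.RelayRaceLocalityNearConstantShortTimeHLMeansNecessary
import HarnessLib

/-!
# `SwapGap` (stmt-AtomisticToContinuum-11850), line `Sketch`, stub `stub_staticBookkeeping` — part II: means of the empirical fields under a general law

Helper file (`--supports stmt-AtomisticToContinuum-11850`) for the registered stub `stub_staticBookkeeping` of the
crux `Summit.AtomisticToContinuum.HydrodynamicLimit.Theses.LambertianContactSwap.SwapGap`. The flow-free,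
law-agnostic half of Yau's bookkeeping: for ANY probability laws `μ_N` on `(N+1)`-sphere phase space,

* `tendsto_means_of_fields` — if the mean squared speed `E_{μ_N}[(N+1)⁻¹∑‖vᵢ‖²]` is bounded, the total kinetic energy
  converges in mean to `∫ E(ρ₁,u₁,θ₁)`, and the empirical density / momentum / energy fields tested against every
  continuous `χ` converge in `μ_N`-probability to `∫χρ₁`, `∫χρ₁u₁`, `∫χE(ρ₁,u₁,θ₁)`, then their EXPECTATIONS converge to
  the same limits (density: bounded convergence; momentum: second moments; energy: Markov from below for `ψ ≥ 0` and
  for `W − ψ`, plus the total energy; signed `χ = χ⁺ − χ⁻`) — adapted from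
  `NearConstantShortTimeHL.meansConverge_of_nearConstantShortTimeHL`, with the flow removed;
* `tendsto_logProfileMean` — hence the mean of a local Gibbs log-profile `A(x) − ‖v − u₁(x)‖²/(2θ₁(x))` is eventually
  `μ_N`-integrable and its expectation tends to `∫ ρ₁ (A − 3/2)` — adapted from
  `NearConstantShortTimeHL.eventually_logProfileMean_ge`, flow-free and with the full limit.

References: H.-T. Yau, Lett. Math. Phys. 22 (1991) §2; C. Kipnis – C. Landim (1999), App. 1 §8.
-/

noncomputable section

open MeasureTheory Filter Set Topology
open scoped ENNReal

namespace Summit.AtomisticToContinuum.HydrodynamicLimit.Theorems.SwapGapStaticBookkeeping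

open Literature.Analysis.FluidPDE Literature.MathematicalPhysics.KineticTheory Literature.Analysis.FunctionSpaces
open Summit.AtomisticToContinuum.HydrodynamicLimit.Theorems.NearConstantShortTimeHL
open Summit.AtomisticToContinuum.HydrodynamicLimit.Theorems.AmplitudeTransfer (integral_apply_V3)

/-- **Convergence in probability of the three fields upgrades to convergence of the means** under a uniform bound on
the mean squared speed and convergence in mean of the total kinetic energy (flow-free, for general probability laws
`μ_N` on `(N+1)`-particle phase space). [cite: KipnisLandim1999, App. 1 §8] -/
theorem tendsto_means_of_fields (μ : (N : ℕ) → Measure (Config (N + 1) (Fin 3) T3))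
    (hμ : ∀ N, IsProbabilityMeasure (μ N)) {ρ₁ θ₁ : T3 → ℝ} {u₁ : T3 → V3} (hρc : Continuous ρ₁)
    (hθc : Continuous θ₁) (huc : Continuous u₁) {B₁ : ℝ}
    (hV : ∀ N, ∫⁻ z, ENNReal.ofReal ((((N + 1 : ℕ)) : ℝ)⁻¹ * ∑ i, ‖(z i).2‖ ^ 2) ∂μ N ≤ ENNReal.ofReal B₁)
    (hKT : Tendsto (fun N => ∫ z, empiricalEnergyField z (fun _ => (1 : ℝ)) ∂μ N) atTop
      (𝓝 (∫ x, totalEnergyDensity (ρ₁ x) (u₁ x) (θ₁ x))))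
    (HL : ∀ χ : T3 → ℝ, Continuous χ → ∀ δ : ℝ, 0 < δ →
      Tendsto (fun N => μ N {z | δ < |empiricalDensityField z χ - ∫ x, χ x * ρ₁ x|}) atTop (𝓝 0) ∧
      Tendsto (fun N => μ N {z | δ < ‖empiricalMomentumField z χ - ∫ x, (χ x * ρ₁ x) • u₁ x‖}) atTop (𝓝 0) ∧
      Tendsto (fun N => μ N {z | δ < |empiricalEnergyField z χ -
        ∫ x, χ x * totalEnergyDensity (ρ₁ x) (u₁ x) (θ₁ x)|}) atTop (𝓝 0))
    (χ : T3 → ℝ) (hχ : Continuous χ) :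
    (∀ N, Integrable (fun z => empiricalDensityField z χ) (μ N) ∧
        Integrable (fun z => empiricalMomentumField z χ) (μ N) ∧
        Integrable (fun z => empiricalEnergyField z χ) (μ N)) ∧
      Tendsto (fun N => ∫ z, empiricalDensityField z χ ∂(μ N)) atTop (𝓝 (∫ x, χ x * ρ₁ x)) ∧
      Tendsto (fun N => ∫ z, empiricalMomentumField z χ ∂(μ N)) atTop (𝓝 (∫ x, (χ x * ρ₁ x) • u₁ x)) ∧
      Tendsto (fun N => ∫ z, empiricalEnergyField z χ ∂(μ N)) atTop
        (𝓝 (∫ x, χ x * totalEnergyDensity (ρ₁ x) (u₁ x) (θ₁ x))) := by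
  -- adapted from `NearConstantShortTimeHL.meansConverge_of_nearConstantShortTimeHL` (flow removed, general laws)
  haveI hPI : ∀ N, IsProbabilityMeasure (μ N) := hμ
  have hEtc : Continuous fun x => totalEnergyDensity (ρ₁ x) (u₁ x) (θ₁ x) := by
    unfold totalEnergyDensity
    exact hρc.mul (((huc.norm.pow 2).div_const 2).add (continuous_const.mul hθc))
  obtain ⟨Cχ, hCχ0, hCχ⟩ := exists_forall_abs_le_of_continuous hχ
  -- the mean squared speed is integrable
  have hKm : ∀ (N : ℕ) (c : ℝ), Measurable fun z : Config (N + 1) (Fin 3) T3 => c * ∑ i, ‖(z i).2‖ ^ 2 :=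
    fun N c => measurable_const.mul (Finset.measurable_sum _ fun i _ => ((measurable_pi_apply i).snd).norm.pow_const 2)
  have hKi : ∀ N : ℕ, Integrable (fun z : Config (N + 1) (Fin 3) T3 => ((N + 1 : ℕ) : ℝ)⁻¹ * ∑ i, ‖(z i).2‖ ^ 2) (μ N) := by
    intro N
    refine ⟨(hKm N _).aestronglyMeasurable, ?_⟩
    rw [hasFiniteIntegral_iff_ofReal (Eventually.of_forall fun z =>
      mul_nonneg (inv_nonneg.2 (Nat.cast_nonneg _)) (Finset.sum_nonneg fun i _ => sq_nonneg _))]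
    exact (hV N).trans_lt ENNReal.ofReal_lt_top
  /- ### DENSITY -/
  have hDm : ∀ N, Measurable fun z : Config (N + 1) (Fin 3) T3 => empiricalDensityField z χ := fun N =>
    (continuous_empiricalDensityField hχ).measurable
  have hDb : ∀ (N : ℕ) (z : Config (N + 1) (Fin 3) T3), |empiricalDensityField z χ| ≤ Cχ := fun N z =>
    abs_empiricalDensityField_le hCχ hCχ0 _
  have hDi : ∀ N, Integrable (fun z => empiricalDensityField z χ) (μ N) := fun N =>
    Integrable.of_bound (hDm N).aestronglyMeasurable Cχ
      (Eventually.of_forall fun z => (Real.norm_eq_abs _).trans_le (hDb N z))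
  have hDT : Tendsto (fun N => ∫ z, empiricalDensityField z χ ∂μ N) atTop (𝓝 (∫ x, χ x * ρ₁ x)) :=
    HardSphereLDA.tendsto_integral_of_tendsto_measure μ hDm hDb fun δ hδ => (HL χ hχ δ hδ).1
  /- ### MOMENTUM -/
  have hMm : ∀ N, Measurable fun z : Config (N + 1) (Fin 3) T3 => empiricalMomentumField z χ := fun N =>
    (continuous_empiricalMomentumField hχ).measurable
  have hMlm : ∀ (N : ℕ) (l : Fin 3), Measurable fun z : Config (N + 1) (Fin 3) T3 => empiricalMomentumField z χ l :=
    fun N l => (EuclideanSpace.proj (𝕜 := ℝ) l).measurable.comp (hMm N)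
  have hMl2 : ∀ (N : ℕ) (l : Fin 3),
      ∫⁻ z, ENNReal.ofReal ((empiricalMomentumField z χ l) ^ 2) ∂μ N ≤ ENNReal.ofReal (Cχ ^ 2 * B₁) := by
    intro N l
    have hpt : ∀ z : Config (N + 1) (Fin 3) T3, ENNReal.ofReal ((empiricalMomentumField z χ l) ^ 2) ≤
        ENNReal.ofReal (Cχ ^ 2) * ENNReal.ofReal (((N + 1 : ℕ) : ℝ)⁻¹ * ∑ i, ‖(z i).2‖ ^ 2) := by
      intro z
      rw [← ENNReal.ofReal_mul (sq_nonneg _)]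
      refine ENNReal.ofReal_le_ofReal ?_
      have h1 : |empiricalMomentumField z χ l| ≤ ‖empiricalMomentumField z χ‖ := by
        simpa using abs_apply_sub_le_norm (empiricalMomentumField z χ) 0 l
      calc (empiricalMomentumField z χ l) ^ 2 = |empiricalMomentumField z χ l| ^ 2 := (sq_abs _).symm
        _ ≤ ‖empiricalMomentumField z χ‖ ^ 2 := pow_le_pow_left₀ (abs_nonneg _) h1 2
        _ ≤ Cχ ^ 2 * (((N + 1 : ℕ) : ℝ)⁻¹ * ∑ i, ‖(z i).2‖ ^ 2) := norm_empiricalMomentumField_sq_le hCχ hCχ0 _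
    calc ∫⁻ z, ENNReal.ofReal ((empiricalMomentumField z χ l) ^ 2) ∂μ N
        ≤ ∫⁻ z, ENNReal.ofReal (Cχ ^ 2) * ENNReal.ofReal (((N + 1 : ℕ) : ℝ)⁻¹ * ∑ i, ‖(z i).2‖ ^ 2) ∂μ N :=
          lintegral_mono hpt
      _ = ENNReal.ofReal (Cχ ^ 2) * ∫⁻ z, ENNReal.ofReal (((N + 1 : ℕ) : ℝ)⁻¹ * ∑ i, ‖(z i).2‖ ^ 2) ∂μ N :=
          lintegral_const_mul' _ _ ENNReal.ofReal_ne_top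
      _ ≤ ENNReal.ofReal (Cχ ^ 2) * ENNReal.ofReal B₁ := mul_le_mul_right (hV N) _
      _ = ENNReal.ofReal (Cχ ^ 2 * B₁) := (ENNReal.ofReal_mul (sq_nonneg _)).symm
  have hIl : ∀ l : Fin 3, (∫ x, (χ x * ρ₁ x) • u₁ x) l = ∫ x, χ x * ρ₁ x * u₁ x l := fun l => by
    have hi : Integrable (fun x => (χ x * ρ₁ x) • u₁ x) (volume : Measure T3) :=
      integrable_of_continuous_T3 ((hχ.mul hρc).smul huc)
    rw [integral_apply_V3 hi l]
    rfl
  have hMlP : ∀ (l : Fin 3) (δ : ℝ), 0 < δ → Tendsto (fun N => μ N {z | δ <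
      |empiricalMomentumField z χ l - ∫ x, χ x * ρ₁ x * u₁ x l|}) atTop (𝓝 0) := by
    intro l δ hδ
    refine tendsto_of_tendsto_of_tendsto_of_le_of_le tendsto_const_nhds (HL χ hχ δ hδ).2.1
      (fun N => bot_le) fun N => ?_
    refine measure_mono fun z hz => ?_
    simp only [mem_setOf_eq] at hz ⊢
    rw [← hIl l] at hz
    exact hz.trans_le (abs_apply_sub_le_norm _ _ l)
  have hMlT : ∀ l : Fin 3, Tendsto (fun N => ∫ z, empiricalMomentumField z χ l ∂μ N) atTop
      (𝓝 (∫ x, χ x * ρ₁ x * u₁ x l)) := fun l =>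
    tendsto_integral_of_tendsto_measure_of_sq_le μ (fun N => hMlm N l) (fun N => hMl2 N l) (hMlP l)
  have hMi : ∀ N, Integrable (fun z => empiricalMomentumField z χ) (μ N) := by
    intro N
    refine Integrable.mono' (((integrable_const (1 : ℝ)).add (hKi N)).const_mul Cχ) (hMm N).aestronglyMeasurable
      (Eventually.of_forall fun z => ?_)
    set K : ℝ := ((N + 1 : ℕ) : ℝ)⁻¹ * ∑ i, ‖(z i).2‖ ^ 2 with hK
    have hK0 : 0 ≤ K := mul_nonneg (inv_nonneg.2 (Nat.cast_nonneg _)) (Finset.sum_nonneg fun i _ => sq_nonneg _)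
    have h := norm_empiricalMomentumField_sq_le hCχ hCχ0 z
    rw [← hK] at h
    show ‖empiricalMomentumField z χ‖ ≤ Cχ * (1 + K)
    have h2 : ‖empiricalMomentumField z χ‖ ^ 2 ≤ (Cχ * (1 + K)) ^ 2 := by
      calc ‖empiricalMomentumField z χ‖ ^ 2 ≤ Cχ ^ 2 * K := h
        _ ≤ (Cχ * (1 + K)) ^ 2 := by
            rw [mul_pow]
            exact mul_le_mul_of_nonneg_left (by nlinarith) (sq_nonneg _)
    exact (pow_le_pow_iff_left₀ (norm_nonneg _) (by positivity) two_ne_zero).1 h2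
  have hMT : Tendsto (fun N => ∫ z, empiricalMomentumField z χ ∂μ N) atTop (𝓝 (∫ x, (χ x * ρ₁ x) • u₁ x)) := by
    refine tendsto_V3_of_apply fun l => ?_
    rw [hIl l]
    refine (hMlT l).congr fun N => ?_
    exact (integral_apply_V3 (hMi N) l).symm
  /- ### ENERGY: nonnegative test functions, then signed ones -/
  have hEm : ∀ (ψ : T3 → ℝ), Continuous ψ → ∀ N, Measurable fun z : Config (N + 1) (Fin 3) T3 => empiricalEnergyField z ψ :=
    fun ψ hψ N => (continuous_empiricalEnergyField hψ).measurable
  have hEi : ∀ (ψ : T3 → ℝ), Continuous ψ → ∀ N, Integrable (fun z => empiricalEnergyField z ψ) (μ N) := by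
    intro ψ hψ N
    obtain ⟨W, hW0, hW⟩ := exists_forall_abs_le_of_continuous hψ
    refine Integrable.mono' ((hKi N).const_mul (W / 2)) (hEm ψ hψ N).aestronglyMeasurable
      (Eventually.of_forall fun z => ?_)
    rw [Real.norm_eq_abs]
    refine (abs_empiricalEnergyField_le hW _).trans (le_of_eq ?_)
    rw [Finset.mul_sum, Finset.mul_sum, Finset.mul_sum, Finset.mul_sum]
    exact Finset.sum_congr rfl fun i _ => by ring
  have key : ∀ (ψ : T3 → ℝ), Continuous ψ → (∀ x, 0 ≤ ψ x) →
      Tendsto (fun N => ∫ z, empiricalEnergyField z ψ ∂μ N) atTop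
        (𝓝 (∫ x, ψ x * totalEnergyDensity (ρ₁ x) (u₁ x) (θ₁ x))) := by
    intro ψ hψ hψ0
    obtain ⟨W, hW0, hW⟩ := exists_forall_abs_le_of_continuous hψ
    set c : ℝ := ∫ x, ψ x * totalEnergyDensity (ρ₁ x) (u₁ x) (θ₁ x) with hcdef
    set et : ℝ := ∫ x, totalEnergyDensity (ρ₁ x) (u₁ x) (θ₁ x) with hetdef
    set ψ' : T3 → ℝ := fun x => W - ψ x with hψ'def
    have hψ'c : Continuous ψ' := continuous_const.sub hψ
    have hψ'0 : ∀ x, 0 ≤ ψ' x := fun x => by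
      have := (le_abs_self _).trans (hW x)
      rw [hψ'def]
      linarith
    have hiE : Integrable (fun x => totalEnergyDensity (ρ₁ x) (u₁ x) (θ₁ x)) (volume : Measure T3) :=
      integrable_of_continuous_T3 hEtc
    have hiψE : Integrable (fun x => ψ x * totalEnergyDensity (ρ₁ x) (u₁ x) (θ₁ x)) (volume : Measure T3) :=
      integrable_of_continuous_T3 (hψ.mul hEtc)
    have hc' : ∫ x, ψ' x * totalEnergyDensity (ρ₁ x) (u₁ x) (θ₁ x) = W * et - c := by
      have e : ∀ x, ψ' x * totalEnergyDensity (ρ₁ x) (u₁ x) (θ₁ x) =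
          W * totalEnergyDensity (ρ₁ x) (u₁ x) (θ₁ x) - ψ x * totalEnergyDensity (ρ₁ x) (u₁ x) (θ₁ x) :=
        fun x => by rw [hψ'def]; ring
      simp_rw [e]
      rw [integral_sub (hiE.const_mul W) hiψE, integral_const_mul]
    have hlow : ∀ κ : ℝ, 0 < κ → ∀ᶠ N in atTop, c - κ ≤ ∫ z, empiricalEnergyField z ψ ∂μ N :=
      fun κ hκ => le_integral_of_tendsto_measure_of_nonneg μ (hEm ψ hψ)
        (fun N z => empiricalEnergyField_nonneg hψ0 _) (hEi ψ hψ) (fun δ hδ => (HL ψ hψ δ hδ).2.2) hκ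
    have hlow' : ∀ κ : ℝ, 0 < κ → ∀ᶠ N in atTop, (W * et - c) - κ ≤ ∫ z, empiricalEnergyField z ψ' ∂μ N := by
      intro κ hκ
      have h := le_integral_of_tendsto_measure_of_nonneg μ (hEm ψ' hψ'c)
        (fun N z => empiricalEnergyField_nonneg hψ'0 _) (hEi ψ' hψ'c) (fun δ hδ => (HL ψ' hψ'c δ hδ).2.2) hκ
      rwa [hc'] at h
    have hsum : ∀ N, ∫ z, empiricalEnergyField z ψ ∂μ N + ∫ z, empiricalEnergyField z ψ' ∂μ N =
        W * ∫ z, empiricalEnergyField z (fun _ => (1 : ℝ)) ∂μ N := by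
      intro N
      rw [← integral_add (hEi ψ hψ N) (hEi ψ' hψ'c N), ← integral_const_mul]
      refine integral_congr_ae (Eventually.of_forall fun z => ?_)
      show empiricalEnergyField z ψ + empiricalEnergyField z ψ' = W * empiricalEnergyField z (fun _ => (1 : ℝ))
      rw [← empiricalEnergyField_add, ← empiricalEnergyField_const_mul]
      congr 1
      funext x
      rw [hψ'def]
      ring
    have hup : ∀ κ : ℝ, 0 < κ → ∀ᶠ N in atTop, ∫ z, empiricalEnergyField z ψ ∂μ N ≤ c + 2 * κ := by
      intro κ hκ
      have hWK : ∀ᶠ N in atTop, W * ∫ z, empiricalEnergyField z (fun _ => (1 : ℝ)) ∂μ N ≤ W * et + κ := by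
        have h1 : Tendsto (fun N => W * ∫ z, empiricalEnergyField z (fun _ => (1 : ℝ)) ∂μ N) atTop (𝓝 (W * et)) :=
          hKT.const_mul W
        exact (h1.eventually (Iic_mem_nhds (by linarith : W * et < W * et + κ))).mono fun N h => h
      filter_upwards [hlow' κ hκ, hWK] with N h1 h2
      have h3 := hsum N
      linarith
    rw [tendsto_order]
    refine ⟨fun a ha => ?_, fun b hb => ?_⟩
    · have hκ : 0 < (c - a) / 2 := by linarith
      filter_upwards [hlow _ hκ] with N hN
      linarith
    · have hκ : 0 < (b - c) / 3 := by linarith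
      filter_upwards [hup _ hκ] with N hN
      linarith
  have hET : Tendsto (fun N => ∫ z, empiricalEnergyField z χ ∂μ N) atTop
      (𝓝 (∫ x, χ x * totalEnergyDensity (ρ₁ x) (u₁ x) (θ₁ x))) := by
    set χp : T3 → ℝ := fun x => max (χ x) 0 with hχp
    set χm : T3 → ℝ := fun x => max (-χ x) 0 with hχm
    have hχpc : Continuous χp := hχ.max continuous_const
    have hχmc : Continuous χm := hχ.neg.max continuous_const
    have hdec : ∀ x, χ x = χp x + (-1) * χm x := fun x => by
      rw [hχp, hχm]
      have := max_zero_sub_max_neg_zero_eq_self (χ x)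
      linarith
    have hp := key χp hχpc fun x => le_max_right _ _
    have hm := key χm hχmc fun x => le_max_right _ _
    have hip : Integrable (fun x => χp x * totalEnergyDensity (ρ₁ x) (u₁ x) (θ₁ x)) (volume : Measure T3) :=
      integrable_of_continuous_T3 (hχpc.mul hEtc)
    have him : Integrable (fun x => -1 * (χm x * totalEnergyDensity (ρ₁ x) (u₁ x) (θ₁ x))) (volume : Measure T3) :=
      (integrable_of_continuous_T3 (hχmc.mul hEtc)).const_mul _
    have hlim : (∫ x, χp x * totalEnergyDensity (ρ₁ x) (u₁ x) (θ₁ x)) + (-1) *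
        ∫ x, χm x * totalEnergyDensity (ρ₁ x) (u₁ x) (θ₁ x) = ∫ x, χ x * totalEnergyDensity (ρ₁ x) (u₁ x) (θ₁ x) := by
      have e1 : (∫ x, χp x * totalEnergyDensity (ρ₁ x) (u₁ x) (θ₁ x)) +
          ∫ x, -1 * (χm x * totalEnergyDensity (ρ₁ x) (u₁ x) (θ₁ x)) =
          ∫ x, (χp x * totalEnergyDensity (ρ₁ x) (u₁ x) (θ₁ x) + -1 * (χm x * totalEnergyDensity (ρ₁ x) (u₁ x) (θ₁ x))) :=
        (integral_add hip him).symm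
      rw [← integral_const_mul, e1]
      refine integral_congr_ae (Eventually.of_forall fun x => ?_)
      show χp x * totalEnergyDensity (ρ₁ x) (u₁ x) (θ₁ x) + -1 * (χm x * totalEnergyDensity (ρ₁ x) (u₁ x) (θ₁ x)) =
        χ x * totalEnergyDensity (ρ₁ x) (u₁ x) (θ₁ x)
      rw [hdec x]
      ring
    rw [← hlim]
    refine ((hp.add (hm.const_mul (-1))).congr fun N => ?_)
    rw [← integral_const_mul, ← integral_add (hEi χp hχpc N) ((hEi χm hχmc N).const_mul _)]
    refine integral_congr_ae (Eventually.of_forall fun z => ?_)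
    show empiricalEnergyField z χp + -1 * empiricalEnergyField z χm = empiricalEnergyField z χ
    rw [← empiricalEnergyField_const_mul, ← empiricalEnergyField_add]
    congr 1
    funext x
    exact (hdec x).symm
  exact ⟨fun N => ⟨hDi N, hMi N, hEi χ hχ N⟩, hDT, hMT, hET⟩

/-- **The mean of a local Gibbs log-profile under laws whose field means converge.** If under probability laws `μ_N`
the expectations of the three empirical fields converge (with integrability) to those of continuous fields
`(ρ₁, u₁, θ₁)`, `θ₁ ≠ 0`, for every continuous test function, then for every continuous `A` the empirical mean of
`A(x) − ‖v − u₁(x)‖²/(2θ₁(x))` is eventually `μ_N`-integrable and its expectation tends to `∫ ρ₁ (A − 3/2)`.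
[cite: Yau1991, §2] -/
theorem tendsto_logProfileMean (μ : (N : ℕ) → Measure (Config (N + 1) (Fin 3) T3)) {ρ₁ θ₁ A : T3 → ℝ} {u₁ : T3 → V3}
    (hρ : Continuous ρ₁) (hθ : Continuous θ₁) (hA : Continuous A) (hu : Continuous u₁) (hθ0 : ∀ x, θ₁ x ≠ 0)
    (hMC : ∀ χ : T3 → ℝ, Continuous χ →
      (∀ N : ℕ, Integrable (fun z => empiricalDensityField z χ) (μ N) ∧
        Integrable (fun z => empiricalMomentumField z χ) (μ N) ∧
        Integrable (fun z => empiricalEnergyField z χ) (μ N)) ∧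
      Tendsto (fun N => ∫ z, empiricalDensityField z χ ∂(μ N)) atTop (𝓝 (∫ x, χ x * ρ₁ x)) ∧
      Tendsto (fun N => ∫ z, empiricalMomentumField z χ ∂(μ N)) atTop (𝓝 (∫ x, (χ x * ρ₁ x) • u₁ x)) ∧
      Tendsto (fun N => ∫ z, empiricalEnergyField z χ ∂(μ N)) atTop
        (𝓝 (∫ x, χ x * totalEnergyDensity (ρ₁ x) (u₁ x) (θ₁ x)))) :
    (∀ N : ℕ, Integrable (fun z => ∫ y, (A y.1 - ‖y.2 - u₁ y.1‖ ^ 2 / (2 * θ₁ y.1)) ∂(empiricalMeasure z)) (μ N)) ∧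
      Tendsto (fun N => ∫ z, (∫ y, (A y.1 - ‖y.2 - u₁ y.1‖ ^ 2 / (2 * θ₁ y.1)) ∂(empiricalMeasure z)) ∂(μ N)) atTop
        (𝓝 (∫ x, ρ₁ x * (A x - 3 / 2))) := by
  -- adapted from `NearConstantShortTimeHL.eventually_logProfileMean_ge` (flow removed, full limit)
  set χ₁ : T3 → ℝ := fun x => A x - ‖u₁ x‖ ^ 2 / (2 * θ₁ x) with hχ₁
  set χ₂ : T3 → ℝ := fun x => -(θ₁ x)⁻¹ with hχ₂
  set χ₃ : Fin 3 → T3 → ℝ := fun l x => u₁ x l / θ₁ x with hχ₃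
  have h2θ : ∀ x, 2 * θ₁ x ≠ 0 := fun x => mul_ne_zero two_ne_zero (hθ0 x)
  have hχ₁c : Continuous χ₁ := hA.sub (((hu.norm).pow 2).div (continuous_const.mul hθ) h2θ)
  have hχ₂c : Continuous χ₂ := (hθ.inv₀ hθ0).neg
  have hχ₃c : ∀ l, Continuous (χ₃ l) := fun l => (continuous_apply_V3 hu l).div hθ hθ0
  obtain ⟨hI₁, hT₁, -, -⟩ := hMC χ₁ hχ₁c
  obtain ⟨hI₂, -, -, hT₂⟩ := hMC χ₂ hχ₂c
  have h₃ := fun l => hMC (χ₃ l) (hχ₃c l)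
  set D : (N : ℕ) → Config (N + 1) (Fin 3) T3 → ℝ := fun N z => empiricalDensityField z χ₁ with hD
  set E : (N : ℕ) → Config (N + 1) (Fin 3) T3 → ℝ := fun N z => empiricalEnergyField z χ₂ with hE
  set Mo : Fin 3 → (N : ℕ) → Config (N + 1) (Fin 3) T3 → V3 := fun l N z => empiricalMomentumField z (χ₃ l) with hMo
  have hdec : ∀ (N : ℕ) (z : Config (N + 1) (Fin 3) T3),
      ∫ y, (A y.1 - ‖y.2 - u₁ y.1‖ ^ 2 / (2 * θ₁ y.1)) ∂(empiricalMeasure z) = D N z + E N z + ∑ l, Mo l N z l :=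
    fun N z => integral_logProfile_empiricalMeasure A θ₁ u₁ _
  have hIall : ∀ N : ℕ, Integrable (D N) (μ N) ∧ Integrable (E N) (μ N) ∧ ∀ l, Integrable (Mo l N) (μ N) :=
    fun N => ⟨(hI₁ N).1, (hI₂ N).2.2, fun l => ((h₃ l).1 N).2.1⟩
  have hcoordInt : ∀ (N : ℕ) (l : Fin 3), Integrable (Mo l N) (μ N) → Integrable (fun z => Mo l N z l) (μ N) :=
    fun N l h => (ContinuousLinearMap.integrable_comp (EuclideanSpace.proj (𝕜 := ℝ) l) h).congr
      (Eventually.of_forall fun z => rfl)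
  have hInt : ∀ N : ℕ, Integrable (fun z => ∫ y, (A y.1 - ‖y.2 - u₁ y.1‖ ^ 2 / (2 * θ₁ y.1))
      ∂(empiricalMeasure z)) (μ N) := by
    intro N
    obtain ⟨hD1, hE1, hM1⟩ := hIall N
    have heq : (fun z : Config (N + 1) (Fin 3) T3 => ∫ y, (A y.1 - ‖y.2 - u₁ y.1‖ ^ 2 / (2 * θ₁ y.1))
        ∂(empiricalMeasure z)) = fun z => D N z + E N z + ∑ l, Mo l N z l := funext (hdec N)
    rw [heq]
    exact (hD1.add hE1).add (integrable_finsetSum _ fun l _ => hcoordInt N l (hM1 l))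
  have hsum : ∀ N : ℕ,
      ∫ z, (∫ y, (A y.1 - ‖y.2 - u₁ y.1‖ ^ 2 / (2 * θ₁ y.1)) ∂(empiricalMeasure z)) ∂(μ N) =
        ∫ z, D N z ∂(μ N) + ∫ z, E N z ∂(μ N) + ∑ l, (∫ z, Mo l N z ∂(μ N)) l := by
    intro N
    obtain ⟨hD1, hE1, hM1⟩ := hIall N
    have hM2 : ∀ l, Integrable (fun z => Mo l N z l) (μ N) := fun l => hcoordInt N l (hM1 l)
    have hS : Integrable (fun z => ∑ l, Mo l N z l) (μ N) := integrable_finsetSum _ fun l _ => hM2 l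
    have e1 : ∫ z, (D N z + E N z + ∑ l, Mo l N z l) ∂(μ N) =
        ∫ z, (D N z + E N z) ∂(μ N) + ∫ z, (∑ l, Mo l N z l) ∂(μ N) := integral_add (hD1.add hE1) hS
    have e2 : ∫ z, (D N z + E N z) ∂(μ N) = ∫ z, D N z ∂(μ N) + ∫ z, E N z ∂(μ N) := integral_add hD1 hE1
    have e3 : ∫ z, (∑ l, Mo l N z l) ∂(μ N) = ∑ l, ∫ z, Mo l N z l ∂(μ N) :=
      integral_finsetSum _ fun l _ => hM2 l
    have e4 : ∑ l, ∫ z, Mo l N z l ∂(μ N) = ∑ l, (∫ z, Mo l N z ∂(μ N)) l :=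
      Finset.sum_congr rfl fun l _ => (integral_apply_V3 (hM1 l) l).symm
    simp_rw [hdec N]
    rw [e1, e2, e3, e4]
  have hρu : ∀ l, Integrable (fun x => (χ₃ l x * ρ₁ x) • u₁ x) volume := fun l =>
    integrable_of_continuous_T3 (((hχ₃c l).mul hρ).smul hu)
  have hlim : Tendsto (fun N : ℕ => ∫ z, D N z ∂(μ N) + ∫ z, E N z ∂(μ N) + ∑ l, (∫ z, Mo l N z ∂(μ N)) l)
      atTop (𝓝 ((∫ x, χ₁ x * ρ₁ x) + (∫ x, χ₂ x * totalEnergyDensity (ρ₁ x) (u₁ x) (θ₁ x)) +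
        ∑ l, (∫ x, (χ₃ l x * ρ₁ x) • u₁ x) l)) := by
    refine (hT₁.add hT₂).add (tendsto_finsetSum _ fun l _ => ?_)
    exact ((EuclideanSpace.proj (𝕜 := ℝ) l).continuous.tendsto _).comp (h₃ l).2.2.1
  have hval : (∫ x, χ₁ x * ρ₁ x) + (∫ x, χ₂ x * totalEnergyDensity (ρ₁ x) (u₁ x) (θ₁ x)) +
      ∑ l, (∫ x, (χ₃ l x * ρ₁ x) • u₁ x) l = ∫ x, ρ₁ x * (A x - 3 / 2) := by
    have hi1 : Integrable (fun x => χ₁ x * ρ₁ x) volume := integrable_of_continuous_T3 (hχ₁c.mul hρ)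
    have hEc : Continuous fun x => totalEnergyDensity (ρ₁ x) (u₁ x) (θ₁ x) := by
      unfold totalEnergyDensity
      exact hρ.mul (((hu.norm.pow 2).div_const 2).add (continuous_const.mul hθ))
    have hi2 : Integrable (fun x => χ₂ x * totalEnergyDensity (ρ₁ x) (u₁ x) (θ₁ x)) volume :=
      integrable_of_continuous_T3 (hχ₂c.mul hEc)
    have hi3 : ∀ l, Integrable (fun x => χ₃ l x * ρ₁ x * u₁ x l) volume := fun l =>
      integrable_of_continuous_T3 (((hχ₃c l).mul hρ).mul (continuous_apply_V3 hu l))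
    have hcoord : ∀ l, (∫ x, (χ₃ l x * ρ₁ x) • u₁ x) l = ∫ x, χ₃ l x * ρ₁ x * u₁ x l := fun l => by
      rw [integral_apply_V3 (hρu l) l]
      rfl
    have hS : Integrable (fun x => ∑ l, χ₃ l x * ρ₁ x * u₁ x l) volume := integrable_finsetSum _ fun l _ => hi3 l
    have e1 : ∑ l, (∫ x, (χ₃ l x * ρ₁ x) • u₁ x) l = ∫ x, (∑ l, χ₃ l x * ρ₁ x * u₁ x l) := by
      rw [integral_finsetSum _ fun l _ => hi3 l]
      exact Finset.sum_congr rfl fun l _ => hcoord l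
    have e2 : (∫ x, χ₁ x * ρ₁ x) + (∫ x, χ₂ x * totalEnergyDensity (ρ₁ x) (u₁ x) (θ₁ x)) =
        ∫ x, (χ₁ x * ρ₁ x + χ₂ x * totalEnergyDensity (ρ₁ x) (u₁ x) (θ₁ x)) := (integral_add hi1 hi2).symm
    have e3 : (∫ x, (χ₁ x * ρ₁ x + χ₂ x * totalEnergyDensity (ρ₁ x) (u₁ x) (θ₁ x))) +
        (∫ x, (∑ l, χ₃ l x * ρ₁ x * u₁ x l)) =
        ∫ x, (χ₁ x * ρ₁ x + χ₂ x * totalEnergyDensity (ρ₁ x) (u₁ x) (θ₁ x) + ∑ l, χ₃ l x * ρ₁ x * u₁ x l) :=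
      (integral_add (hi1.add hi2) hS).symm
    rw [e1, e2, e3]
    refine integral_congr_ae (Eventually.of_forall fun x => ?_)
    exact logProfile_limit_integrand (A x) (ρ₁ x) (θ₁ x) (u₁ x) (hθ0 x)
  rw [hval] at hlim
  exact ⟨hInt, hlim.congr fun N => (hsum N).symm⟩

end Summit.AtomisticToContinuum.HydrodynamicLimit.Theorems.SwapGapStaticBookkeeping

end
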